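import Literature.AlgebraicGeometry.ComplexMultiplication.CyclotomicFermatCMTypesKoblitzListOddQuadraticCharacter
import Literature.NumberTheory.LFunctions.BernoulliOneCharOddPrimitiveBound
import HarnessLib

/-!
# Koblitz's list at an ARBITRARY level, II: the conductor of the odd quadratic character of a group triple is BOUNDED —
# `φ(f) ≤ (12/π)·√f·log f`, hence `f < 2²¹` — and the K–R type is determined modulo `f`

Layer `Literature/AlgebraicGeometry/ComplexMultiplication`, namespace `…ComplexMultiplication.CyclotomicFermatCMType`; sequel of
`CyclotomicFermatCMTypesKoblitzListOddQuadraticCharacter` (this lane gen 44: for every group triple at every level `N`, `H = ker χ` with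
`χ` odd quadratic modulo `N`, and the conductor bound `φ(f) ≤ 12·|B_{1,χ₁}|`) and `Literature/NumberTheory/LFunctions/
BernoulliOneCharOddPrimitiveBound` (`|B_{1,χ}| ≤ π⁻¹√f·log f` for odd primitive `χ`).  THEOREMS ONLY (no definition, no named fact, no
`sorry`, no kernel computation beyond numerals).

THE SOURCES (held, read first-hand).  M. Bauer, A. Coste, C. Itzykson, P. Ruelle, J. Geom. Phys. **22** (1997) §3.4 p. 14 (held
`paper:arxiv-hep-th_9604104`): «no `L_{r,s,t}` is isogenous to a product of elliptic factors unless `n₀` belongs to the following set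
`{3, 4, 6, 7, 8, 12, 15, 16, 18, 20, 21, 22, 24, 30, 39, 40, 48, 60}` [kob]» — in particular the set of levels is FINITE ([kob] = N. Koblitz,
Duke Math. J. **45** (1978) 87–99, NOT held, acq-13447).  N. Koblitz, D. Rohrlich, Canad. J. Math. **30** (1978) §2 p. 1187 (the character
display).  J. Oesterlé, Enseign. Math. **34** (1988) II §3 (27) (`h(−d) ≤ π⁻¹√d log d`).  G. H. Hardy, E. M. Wright, *An Introduction to the
Theory of Numbers*, §18.4 Thm. 327–328 (the order of `φ(n)`: `φ(n)/n ≥ ∏_{p∣n}(1 − 1/p)`, «`φ(n) > n/(C log log n)`»; here only the crude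
`φ(n) ≥ n/(ω(n) + 1) ≥ n/(log₂ n + 1)` is used).

THE POINT.  The sibling bounds the conductor `f` of the odd quadratic character `χ` cut out by a group triple by `φ(f) ≤ 12·|B_{1,χ₁}|`
(`χ₁` primitive of conductor `f`), and `|B_{1,χ₁}| ≤ π⁻¹√f·log f`; so `φ(f) ≤ (12/π)√f log f`.  With `f ≤ φ(f)·(⌊log₂ f⌋ + 1)` (the `i`-th
prime factor of `f` is `≥ i + 1`, so `∏(1 − 1/p) ≥ 1/(ω + 1)`, and `2^ω ≤ f`) and `log f < (⌊log₂ f⌋ + 1)·log 2`, `12·log 2/π < 2.78`: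
`√f < 2.78·(⌊log₂ f⌋ + 1)²`, `f < 8·(⌊log₂ f⌋ + 1)⁴`, impossible once `⌊log₂ f⌋ ≥ 21`.  Hence **`f < 2²¹`** for the conductor of the character
of ANY group triple at ANY level: the first LEVEL-FREE finiteness statement of this series (all previous files fix the prime support of
the level).  Moreover `H = ker χ` is a union of fibres of `(ℤ/N)ˣ → (ℤ/f)ˣ` (§1): the K–R type is induced from `ℚ(ζ_f)`.

## What is proved (namespace `…CyclotomicFermatCMType`)

* §1 **`mem_iff_mem_of_castHom_conductor_eq`** (`S = {χ = 1}`: membership of a unit depends only on its class modulo `f = cond χ`),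
  `mem_fermat_iff_mem_of_castHom_conductor_eq` (the same for a closed `H_{r,s,−r−s}` and its character).
* §2 `prod_le_card_succ_mul_prod_sub_one` (`∏_{x∈s} x ≤ (|s|+1)·∏_{x∈s}(x−1)` for a set of integers `≥ 2`),
  **`le_totient_mul_log_two_succ`** (`n ≤ φ(n)·(⌊log₂ n⌋ + 1)`), **`totient_conductor_le_sqrt_mul_log`** (`φ(f) ≤ 12·π⁻¹·√f·log f`),
  `eight_mul_pow_four_le_two_pow` (`8(L+1)⁴ ≤ 2^L`, `L ≥ 21`), **`conductor_lt_two_pow_of_forall_apply_eq_one`** (`f < 2²¹`),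
  **`exists_character_conductor_lt_of_forall_mul_mem`** (H closed ⟹ the odd quadratic `χ` with `H = ker χ` has `cond χ < 2²¹`).

## Honest column / NOT here

* THE PROOF IS OURS, NOT KOBLITZ'S ([kob] not held).  The bound `2²¹` on the CONDUCTOR is crude (sharp inputs would be `|L(1,χ)| ≤ ½log f + O(1)`
  and `φ(n) ≫ n/log log n`); it is NOT a bound on the LEVEL `N` or on `n₀` — the primes of `N` outside `f` absorbed by one entry are not
  bounded here (that, and the census of conductors `f < 2²¹`, is [kob] proper and remains with the successor).
* Statements are about the K–R residue sets `H_{r,s,t}`; the Fermat curve and its Jacobian are not constructed.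

## References

* [BauerCosteItzyksonRuelle1997] M. Bauer, A. Coste, C. Itzykson, P. Ruelle, J. Geom. Phys. 22 (1997) 134–189, §3.4 (p. 14).
* [KoblitzRohrlich1978] N. Koblitz, D. Rohrlich, Canad. J. Math. 30 (1978) 1183–1205, §2 (p. 1187).
* [Oesterle1988Gauss] J. Oesterlé, Enseign. Math. (2) 34 (1988), II §3 Proposition p. 57, (27).
* [HardyWright2008] G. H. Hardy, E. M. Wright, *An Introduction to the Theory of Numbers*, 6th ed., §18.4, Thms. 327–328.
* [Washington1997] L. C. Washington, *Introduction to Cyclotomic Fields*, Ch. 3 (conductors).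
* [kob] N. Koblitz, Duke Math. J. 45 (1978) 87–99 — cited for the statement of the list only; not held, not used.

## Provenance

Cell `pub-hodgecm2` (COR-CM), literature seat `lit-deligne-3` gen 44 (claim KOBLITZ-CONDUCTOR-FINITE; count-neutral, own lane).  HC_CM is NOT
proved and nothing here bears on it.
-/

noncomputable section

open NumberField

namespace Literature.AlgebraicGeometry.ComplexMultiplication

open Literature.NumberTheory.LFunctions
open Literature.AlgebraicGeometry.HodgeTheory (fermatCMType)
open CyclotomicCMTypeResidueSets (IsCMResidueSet unitResidues)

namespace CyclotomicFermatCMType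

/-! ## §1 `H = ker χ` is determined modulo the conductor -/

section ModConductor

variable {N : ℕ} [NeZero N]

omit [NeZero N] in
/-- **`S = {u : χ(u) = 1}` is a union of fibres of `(ℤ/N)ˣ → (ℤ/f)ˣ`, `f` the conductor of `χ`**: for units `u, v` with `u ≡ v (mod f)`,
`u ∈ S ⟺ v ∈ S` (`χ = χ₁ ∘ (mod f)` for the primitive character `χ₁`). [cite: Washington1997, Ch. 3 (conductor, primitive character)]
[cite: KoblitzRohrlich1978, §1 (p. 1184)] -/
theorem mem_iff_mem_of_castHom_conductor_eq {S : Finset (ZMod N)} {χ : DirichletCharacter ℂ N}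
    (hS : ∀ x : ZMod N, x ∈ S ↔ IsUnit x ∧ χ x = 1) {u v : ZMod N} (hu : IsUnit u) (hv : IsUnit v)
    (huv : ZMod.castHom χ.conductor_dvd_level (ZMod χ.conductor) u = ZMod.castHom χ.conductor_dvd_level (ZMod χ.conductor) v) :
    u ∈ S ↔ v ∈ S := by
  have key : ∀ w : ZMod N, IsUnit w →
      χ w = χ.primitiveCharacter (ZMod.castHom χ.conductor_dvd_level (ZMod χ.conductor) w) := by
    intro w hw
    conv_lhs => rw [← DirichletCharacter.changeLevel_primitiveCharacter χ, ← hw.unit_spec]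
    rw [DirichletCharacter.changeLevel_eq_cast_of_dvd χ.primitiveCharacter χ.conductor_dvd_level hw.unit, ZMod.castHom_apply,
      hw.unit_spec]
  rw [hS u, hS v, key u hu, key v hv, huv]
  exact ⟨fun h => ⟨hv, h.2⟩, fun h => ⟨hu, h.2⟩⟩

/-- **THE K–R TYPE OF A GROUP TRIPLE IS INDUCED FROM LEVEL `f`**: for an admissible normalised pair `(r, s)` modulo `N` with
`H = H_{r,s,−r−s}` closed under multiplication, there is an odd quadratic character `χ` modulo `N` with `H = ker χ`, and membership of a
unit in `H` depends only on its residue modulo the conductor `f` of `χ`. [cite: KoblitzRohrlich1978, §1 (p. 1184)]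
[cite: BauerCosteItzyksonRuelle1997, §3.4 (p. 14)] -/
theorem mem_fermat_iff_mem_of_castHom_conductor_eq {r s : ZMod N} (hr : r ≠ 0) (hs : s ≠ 0) (hrs : r.val + s.val < N)
    (hcl : ∀ a ∈ fermatCMType N r s (-(r + s)), ∀ b ∈ fermatCMType N r s (-(r + s)),
      a * b ∈ fermatCMType N r s (-(r + s))) :
    ∃ χ : DirichletCharacter ℂ N, χ.Odd ∧ χ ^ 2 = 1 ∧
      (∀ x : ZMod N, x ∈ fermatCMType N r s (-(r + s)) ↔ IsUnit x ∧ χ x = 1) ∧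
      ∀ u v : ZMod N, IsUnit u → IsUnit v →
        ZMod.castHom χ.conductor_dvd_level (ZMod χ.conductor) u = ZMod.castHom χ.conductor_dvd_level (ZMod χ.conductor) v →
          (u ∈ fermatCMType N r s (-(r + s)) ↔ v ∈ fermatCMType N r s (-(r + s))) := by
  obtain ⟨χ, hodd, hχ2, hH⟩ := exists_dirichletCharacter_of_forall_mul_mem_fermat hr hs hrs hcl
  exact ⟨χ, hodd, hχ2, hH, fun u v hu hv huv => mem_iff_mem_of_castHom_conductor_eq hH hu hv huv⟩

end ModConductor

/-! ## §2 `f ≤ φ(f)(⌊log₂ f⌋ + 1)`, `φ(f) ≤ (12/π)√f log f`, hence `f < 2²¹` -/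

section Finite

/-- For a finite set `s` of integers `≥ 2`: `∏_{x∈s} x ≤ (|s| + 1)·∏_{x∈s}(x − 1)` — remove the maximum `a ≥ |s| + 1` and use
`a·(|s|) ≤ (|s| + 1)·(a − 1)`; the `i`-th smallest element is `≥ i + 1` (Hardy–Wright's `∏(1 − 1/p)` over the primes of `n`).
[cite: HardyWright2008, §18.4 (proof of Thm. 328)] -/
theorem prod_le_card_succ_mul_prod_sub_one (s : Finset ℕ) (hs : ∀ x ∈ s, 2 ≤ x) :
    ∏ x ∈ s, x ≤ (s.card + 1) * ∏ x ∈ s, (x - 1) := by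
  classical
  induction s using Finset.induction_on_max with
  | empty => simp
  | insert a s hlt ih =>
    have ha : a ∉ s := fun h => lt_irrefl a (hlt a h)
    have hs' : ∀ x ∈ s, 2 ≤ x := fun x hx => hs x (Finset.mem_insert_of_mem hx)
    have ha2 : 2 ≤ a := hs a (Finset.mem_insert_self a s)
    have hcard : s.card + 2 ≤ a := by
      have hsub : s ⊆ Finset.Ico 2 a := fun x hx => Finset.mem_Ico.2 ⟨hs' x hx, hlt x hx⟩
      have h := Finset.card_le_card hsub
      rw [Nat.card_Ico] at h
      omega
    obtain ⟨b, rfl⟩ : ∃ b, a = b + 2 := ⟨a - 2, by omega⟩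
    rw [Finset.prod_insert ha, Finset.prod_insert ha, Finset.card_insert_of_notMem ha, show b + 2 - 1 = b + 1 by omega]
    have ih' := ih hs'
    calc (b + 2) * ∏ x ∈ s, x ≤ (b + 2) * ((s.card + 1) * ∏ x ∈ s, (x - 1)) := Nat.mul_le_mul_left _ ih'
      _ = ((b + 2) * (s.card + 1)) * ∏ x ∈ s, (x - 1) := by ring
      _ ≤ ((s.card + 1 + 1) * (b + 1)) * ∏ x ∈ s, (x - 1) := by
          apply Nat.mul_le_mul_right
          nlinarith [hcard]
      _ = (s.card + 1 + 1) * ((b + 1) * ∏ x ∈ s, (x - 1)) := by ring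

/-- **`n ≤ φ(n)·(⌊log₂ n⌋ + 1)`** for `n ≠ 0`: `φ(n)·∏_{p∣n} p = n·∏_{p∣n}(p − 1)` (Mathlib), `∏ p ≤ (ω(n) + 1)·∏(p − 1)` by the previous
lemma, and `2^{ω(n)} ≤ ∏ p ≤ n`. (A crude form of Hardy–Wright Thm. 328 `φ(n) > n/(C log log n)`.) [cite: HardyWright2008, §18.4 Thm. 328] -/
theorem le_totient_mul_log_two_succ (n : ℕ) (hn : n ≠ 0) : n ≤ n.totient * (Nat.log 2 n + 1) := by
  have hkey := Nat.totient_mul_prod_primeFactors n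
  have hP := prod_le_card_succ_mul_prod_sub_one n.primeFactors fun p hp => (Nat.prime_of_mem_primeFactors hp).two_le
  have hω : n.primeFactors.card ≤ Nat.log 2 n := by
    have h2 : 2 ^ n.primeFactors.card ≤ ∏ p ∈ n.primeFactors, p := by
      rw [← Finset.prod_const]
      exact Finset.prod_le_prod' fun p hp => (Nat.prime_of_mem_primeFactors hp).two_le
    have h3 : ∏ p ∈ n.primeFactors, p ≤ n := Nat.le_of_dvd (Nat.pos_of_ne_zero hn) (Nat.prod_primeFactors_dvd n)
    exact Nat.le_log_of_pow_le (by norm_num) (h2.trans h3)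
  have hpos : 0 < ∏ p ∈ n.primeFactors, (p - 1) :=
    Finset.prod_pos fun p hp => by have := (Nat.prime_of_mem_primeFactors hp).two_le; omega
  have h1 : n * ∏ p ∈ n.primeFactors, (p - 1) ≤ (n.totient * (n.primeFactors.card + 1)) * ∏ p ∈ n.primeFactors, (p - 1) := by
    calc n * ∏ p ∈ n.primeFactors, (p - 1) = n.totient * ∏ p ∈ n.primeFactors, p := hkey.symm
      _ ≤ n.totient * ((n.primeFactors.card + 1) * ∏ p ∈ n.primeFactors, (p - 1)) := Nat.mul_le_mul_left _ hP
      _ = (n.totient * (n.primeFactors.card + 1)) * ∏ p ∈ n.primeFactors, (p - 1) := by ring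
  have h2 := Nat.le_of_mul_le_mul_right h1 hpos
  calc n ≤ n.totient * (n.primeFactors.card + 1) := h2
    _ ≤ n.totient * (Nat.log 2 n + 1) := Nat.mul_le_mul_left _ (by omega)

variable {N : ℕ} [NeZero N]

/-- **`φ(f) ≤ 12·π⁻¹·√f·log f`** for the conductor `f` of an odd character `χ` modulo ANY `N` equal to `1` on the residue set `H_{r,s,t}` of an
admissible triple: the sibling's `φ(f) ≤ 12·|B_{1,χ₁}|` with `|B_{1,χ₁}| ≤ π⁻¹√f log f` (χ₁ odd primitive of conductor `f ≥ 3`).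
[cite: KoblitzRohrlich1978, §2 (p. 1187)] [cite: Oesterle1988Gauss, II §3 Proposition p. 57 (27)] -/
theorem totient_conductor_le_sqrt_mul_log {r s t : ZMod N} (hr : r ≠ 0) (hs : s ≠ 0) (ht : t ≠ 0) (hrst : r + s + t = 0)
    {χ : DirichletCharacter ℂ N} (hodd : χ.Odd) (hH : ∀ h ∈ fermatCMType N r s t, χ h = 1) :
    (χ.conductor.totient : ℝ) ≤ 12 * (Real.pi⁻¹ * Real.sqrt χ.conductor * Real.log χ.conductor) := by
  have h1 := totient_conductor_le_of_forall_apply_eq_one hr hs ht hrst hodd hH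
  haveI : NeZero χ.conductor := ⟨χ.conductor_ne_zero⟩
  have hf1 : χ.conductor ≠ 1 := fun h =>
    OddCharLogDeriv.ne_one_of_odd hodd (DirichletCharacter.eq_one_iff_conductor_eq_one.2 h)
  have h2 := BernoulliOneCharBound.norm_bernoulliOneChar_le_sqrt_mul_log χ.primitiveCharacter_isPrimitive
    (RelativeClassNumber.Odd.primitiveCharacter hodd) hf1
  linarith

/-- `8·(L + 1)⁴ ≤ 2^L` for `L ≥ 21`. [folklore] -/
private theorem eight_mul_pow_four_le_two_pow {L : ℕ} (hL : 21 ≤ L) : 8 * (L + 1) ^ 4 ≤ 2 ^ L := by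
  induction L, hL using Nat.le_induction with
  | base => norm_num
  | succ n hn ih =>
    have h22 : 22 * (n + 2) ≤ 23 * (n + 1) := by omega
    have h4 : (22 * (n + 2)) ^ 4 ≤ (23 * (n + 1)) ^ 4 := Nat.pow_le_pow_left h22 4
    have hstep : 22 ^ 4 * (n + 2) ^ 4 ≤ 22 ^ 4 * (2 * (n + 1) ^ 4) := by
      calc 22 ^ 4 * (n + 2) ^ 4 = (22 * (n + 2)) ^ 4 := by ring
        _ ≤ (23 * (n + 1)) ^ 4 := h4
        _ = 23 ^ 4 * (n + 1) ^ 4 := by ring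
        _ ≤ (2 * 22 ^ 4) * (n + 1) ^ 4 := Nat.mul_le_mul_right _ (by norm_num)
        _ = 22 ^ 4 * (2 * (n + 1) ^ 4) := by ring
    have hstep' : (n + 2) ^ 4 ≤ 2 * (n + 1) ^ 4 := Nat.le_of_mul_le_mul_left hstep (by norm_num)
    calc 8 * (n + 1 + 1) ^ 4 = 8 * (n + 2) ^ 4 := by ring
      _ ≤ 8 * (2 * (n + 1) ^ 4) := Nat.mul_le_mul_left _ hstep'
      _ = 2 * (8 * (n + 1) ^ 4) := by ring
      _ ≤ 2 * 2 ^ n := Nat.mul_le_mul_left _ ih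
      _ = 2 ^ (n + 1) := by ring

/-- **THE CONDUCTOR OF THE CHARACTER OF A GROUP TRIPLE IS `< 2²¹`**: for an admissible triple at ANY level `N` and an odd character `χ`
modulo `N` equal to `1` on `H_{r,s,t}`: `f = cond χ < 2²¹`.  From `f ≤ φ(f)(L + 1)` (`L = ⌊log₂ f⌋`), `φ(f) ≤ 12π⁻¹√f log f`,
`log f < (L + 1) log 2`, `12·log 2/π < 2.78`: `√f < 2.78(L+1)²`, `f < 8(L+1)⁴ ≤ 2^L ≤ f` once `L ≥ 21`.  (A finite list of conductors —
the level-free half of the finiteness in Koblitz's theorem [kob]; the census of that list and the level bound are not here.)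
[cite: BauerCosteItzyksonRuelle1997, §3.4 (p. 14)] [cite: KoblitzRohrlich1978, §2 (p. 1187)] [cite: Oesterle1988Gauss, II §3 (27)] -/
theorem conductor_lt_two_pow_of_forall_apply_eq_one {r s t : ZMod N} (hr : r ≠ 0) (hs : s ≠ 0) (ht : t ≠ 0) (hrst : r + s + t = 0)
    {χ : DirichletCharacter ℂ N} (hodd : χ.Odd) (hH : ∀ h ∈ fermatCMType N r s t, χ h = 1) :
    χ.conductor < 2 ^ 21 := by
  set f := χ.conductor with hf
  have hf0 : f ≠ 0 := χ.conductor_ne_zero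
  have hf1 : f ≠ 1 := fun h =>
    OddCharLogDeriv.ne_one_of_odd hodd (DirichletCharacter.eq_one_iff_conductor_eq_one.2 h)
  have hA := totient_conductor_le_sqrt_mul_log hr hs ht hrst hodd hH
  have hB := le_totient_mul_log_two_succ f hf0
  set L := Nat.log 2 f with hL
  by_contra hge
  push Not at hge
  have hL21 : 21 ≤ L := Nat.le_log_of_pow_le (by norm_num) hge
  have h2L : 2 ^ L ≤ f := Nat.pow_log_le_self 2 hf0
  have hlt : f < 2 ^ (L + 1) := Nat.lt_pow_succ_log_self (by norm_num) f
  have h8 := eight_mul_pow_four_le_two_pow hL21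
  -- to `ℝ`
  have hfR : (0 : ℝ) < f := by exact_mod_cast Nat.pos_of_ne_zero hf0
  have hf2 : (1 : ℝ) < f := by
    have : 2 ≤ f := by omega
    exact_mod_cast this
  have hlog2 := Real.log_two_lt_d9
  have hlog2pos : 0 < Real.log 2 := Real.log_pos (by norm_num)
  have hpi := Real.pi_gt_three
  have hπinv : Real.pi⁻¹ < 1 / 3 := by
    rw [inv_eq_one_div]
    exact one_div_lt_one_div_of_lt (by norm_num) hpi
  have hπinv_pos : 0 < Real.pi⁻¹ := inv_pos.2 Real.pi_pos
  have hlogf : Real.log f < ((L : ℝ) + 1) * Real.log 2 := by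
    have h' : (f : ℝ) < (2 : ℝ) ^ (L + 1) := by exact_mod_cast hlt
    calc Real.log f < Real.log ((2 : ℝ) ^ (L + 1)) := Real.log_lt_log hfR h'
      _ = ((L : ℝ) + 1) * Real.log 2 := by rw [Real.log_pow]; push_cast; ring
  have hlogf_pos : 0 < Real.log f := Real.log_pos hf2
  have hsqrt_pos : 0 < Real.sqrt f := Real.sqrt_pos.2 hfR
  have hBR : (f : ℝ) ≤ (f.totient : ℝ) * ((L : ℝ) + 1) := by exact_mod_cast hB
  have hL1 : (0 : ℝ) < (L : ℝ) + 1 := by positivity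
  -- the constant `12·π⁻¹·log 2 < 2.78`
  have hconst : 12 * (Real.pi⁻¹ * Real.log 2) < 2.78 := by
    nlinarith [mul_pos (sub_pos.2 hπinv) hlog2pos, mul_pos (sub_pos.2 hlog2) (show (0 : ℝ) < 1 / 3 by norm_num)]
  -- `f ≤ φ(f)(L+1) ≤ 12π⁻¹√f·log f·(L+1) < 12π⁻¹√f·(L+1)² log 2 < 2.78·√f·(L+1)²`
  have hstep1 : (f : ℝ) ≤ 12 * (Real.pi⁻¹ * Real.sqrt f * Real.log f) * ((L : ℝ) + 1) := by
    calc (f : ℝ) ≤ (f.totient : ℝ) * ((L : ℝ) + 1) := hBR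
      _ ≤ 12 * (Real.pi⁻¹ * Real.sqrt f * Real.log f) * ((L : ℝ) + 1) := mul_le_mul_of_nonneg_right hA hL1.le
  have hstep2 : 12 * (Real.pi⁻¹ * Real.sqrt f * Real.log f) * ((L : ℝ) + 1) <
      12 * (Real.pi⁻¹ * Real.sqrt f * (((L : ℝ) + 1) * Real.log 2)) * ((L : ℝ) + 1) := by
    have hc : 0 < 12 * (Real.pi⁻¹ * Real.sqrt f) * ((L : ℝ) + 1) := by positivity
    nlinarith [mul_lt_mul_of_pos_left hlogf hc]
  have hstep3 : 12 * (Real.pi⁻¹ * Real.sqrt f * (((L : ℝ) + 1) * Real.log 2)) * ((L : ℝ) + 1) ≤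
      2.78 * Real.sqrt f * ((L : ℝ) + 1) ^ 2 := by
    have e : 12 * (Real.pi⁻¹ * Real.sqrt f * (((L : ℝ) + 1) * Real.log 2)) * ((L : ℝ) + 1) =
        (12 * (Real.pi⁻¹ * Real.log 2)) * (Real.sqrt f * ((L : ℝ) + 1) ^ 2) := by ring
    rw [e, show 2.78 * Real.sqrt f * ((L : ℝ) + 1) ^ 2 = 2.78 * (Real.sqrt f * ((L : ℝ) + 1) ^ 2) by ring]
    exact mul_le_mul_of_nonneg_right hconst.le (by positivity)
  have hsq : Real.sqrt f * Real.sqrt f < 2.78 * ((L : ℝ) + 1) ^ 2 * Real.sqrt f := by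
    rw [Real.mul_self_sqrt hfR.le]
    calc (f : ℝ) < 2.78 * Real.sqrt f * ((L : ℝ) + 1) ^ 2 := by linarith
      _ = 2.78 * ((L : ℝ) + 1) ^ 2 * Real.sqrt f := by ring
  have hroot : Real.sqrt f < 2.78 * ((L : ℝ) + 1) ^ 2 := lt_of_mul_lt_mul_right hsq hsqrt_pos.le
  have hf4 : (f : ℝ) < (2.78 * ((L : ℝ) + 1) ^ 2) * (2.78 * ((L : ℝ) + 1) ^ 2) := by
    rw [← Real.mul_self_sqrt hfR.le]
    exact mul_lt_mul'' hroot hroot hsqrt_pos.le hsqrt_pos.le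
  -- `f < 7.73(L+1)⁴ < 8(L+1)⁴ ≤ 2^L ≤ f`
  have h8R : (8 : ℝ) * ((L : ℝ) + 1) ^ 4 ≤ (2 : ℝ) ^ L := by exact_mod_cast h8
  have h2LR : (2 : ℝ) ^ L ≤ f := by exact_mod_cast h2L
  have hL4 : (0 : ℝ) < ((L : ℝ) + 1) ^ 4 := by positivity
  nlinarith

/-- **KOBLITZ'S LIST AT AN ARBITRARY LEVEL — FINITELY MANY CONDUCTORS**: for every admissible normalised pair `(r, s)` modulo `N` (`r, s ≠ 0`,
`⟨r⟩ + ⟨s⟩ < N`) with `H = H_{r,s,−r−s}` closed under multiplication (BCIR: `L_{r,s,t}` a product of elliptic factors), the odd quadratic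
character `χ` modulo `N` with `H = ker χ` has conductor `f < 2²¹` (and `φ(f) ≤ 12|B_{1,χ₁}| ≤ (12/π)√f log f`).  With §1, `H` is the pull-back of
the index-`2` subgroup `ker χ₁ ⊂ (ℤ/f)ˣ` for one of finitely many `f`. [cite: BauerCosteItzyksonRuelle1997, §3.4 (p. 14)]
[cite: KoblitzRohrlich1978, §1 (p. 1184), §2 (p. 1187)] -/
theorem exists_character_conductor_lt_of_forall_mul_mem {r s : ZMod N} (hr : r ≠ 0) (hs : s ≠ 0) (hrs : r.val + s.val < N)
    (hcl : ∀ a ∈ fermatCMType N r s (-(r + s)), ∀ b ∈ fermatCMType N r s (-(r + s)),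
      a * b ∈ fermatCMType N r s (-(r + s))) :
    ∃ χ : DirichletCharacter ℂ N, χ.Odd ∧ χ ^ 2 = 1 ∧
      (∀ x : ZMod N, x ∈ fermatCMType N r s (-(r + s)) ↔ IsUnit x ∧ χ x = 1) ∧
      χ.conductor < 2 ^ 21 ∧
      (χ.conductor.totient : ℝ) ≤ 12 * (Real.pi⁻¹ * Real.sqrt χ.conductor * Real.log χ.conductor) := by
  obtain ⟨χ, hodd, hχ2, hH⟩ := exists_dirichletCharacter_of_forall_mul_mem_fermat hr hs hrs hcl
  have hsum_val : (r + s).val = r.val + s.val := ZMod.val_add_of_lt hrs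
  have ht : -(r + s) ≠ 0 := by
    intro h
    rw [neg_eq_zero] at h
    have h1 := (ZMod.val_eq_zero (r + s)).2 h
    rw [hsum_val] at h1
    have : r.val ≠ 0 := fun h0 => hr ((ZMod.val_eq_zero r).1 h0)
    omega
  have hrst : r + s + -(r + s) = 0 := add_neg_cancel _
  have hH' : ∀ h ∈ fermatCMType N r s (-(r + s)), χ h = 1 := fun h hh => ((hH h).1 hh).2
  exact ⟨χ, hodd, hχ2, hH, conductor_lt_two_pow_of_forall_apply_eq_one hr hs ht hrst hodd hH',
    totient_conductor_le_sqrt_mul_log hr hs ht hrst hodd hH'⟩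

end Finite

end CyclotomicFermatCMType

end Literature.AlgebraicGeometry.ComplexMultiplication
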